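import Mathlib
import Literature.MathematicalPhysics.StatisticalMechanics.Crystallization
import Literature.MathematicalPhysics.StatisticalMechanics.LennardJonesClusters
import Literature.MathematicalPhysics.StatisticalMechanics.OneCrossingMixture
import Summits.AtomisticToContinuum.Crystallization.Theses.ReggeStarCoercivity

/-!
# Route `ReggeStarCoercivity`, crux stmt-AtomisticToContinuum-13601 `StabilityConstantTwelve`
# — line `Sketch`, stub `stub_cert_crossing` (Descartes: one sign change ⇒ one crossing)

For `σ > 0` and coefficients `b_q` that are `≤ 0` for `q < k` and `≥ 0` for `q ≥ k`, with some
`b_q < 0` below `k` and some `b_q > 0` in `[k, K)`, the density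
`a(t) = e^{-σt} Σ_{q<K} b_q σ^{q+2} t^{q+1}/(q+1)!` is `≤ 0` on `(0,t₀)` and `≥ 0` on `[t₀,∞)`
for some `t₀ > 0`.

Proof.  Put `c_q := b_q σ^{q+2}/(q+1)!` (same sign as `b_q`) and `P(t) := Σ_{q<K} c_q t^{q+1}`,
so `a(t) = e^{-σt} P(t)` has the sign of `P(t)`.
* Monotonicity (division-free form of "`P(t)/t^{k+1}` is strictly increasing on `(0,∞)`"):
  for `0 < s < t`, `P(s) t^{k+1} < P(t) s^{k+1}`, termwise from `s^n t^m ≤ t^n s^m` (`m ≤ n`),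
  with strict inequality at the strictly negative coefficient.  Hence a non-negative value of `P`
  propagates to strictly positive values to the right, a non-positive value to strictly negative
  values to the left.
* `P < 0` somewhere on `(0,∞)`: dropping the non-positive terms below the negative index `q₀`,
  `P(u) ≤ u^{q₀+1} G(u)` with `G` a polynomial, `G(0) = c_{q₀} < 0`, so `G(u) < 0` for small `u > 0`.
* `P > 0` somewhere: dropping the non-negative terms above the positive index `q₁`,
  `P(1/u) ≥ u^{-(q₁+1)} H(u)` with `H` a polynomial, `H(0) = c_{q₁} > 0`.
* The intermediate value theorem gives a zero `t₀` of `P` between the two points, and the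
  propagation gives `P < 0` on `(0,t₀)`, `P ≥ 0` on `[t₀,∞)`.
-/

noncomputable section

namespace Summit.AtomisticToContinuum.Crystallization.Theorems

open MeasureTheory Set Real
open scoped Nat
open Literature.MathematicalPhysics.StatisticalMechanics

/-- Monomial comparison: for `0 ≤ s ≤ t` and `m ≤ n`, `s^n t^m ≤ t^n s^m`. -/
theorem certCrossing_pow_mul_pow_le {s t : ℝ} (hs : 0 ≤ s) (hst : s ≤ t) {m n : ℕ}
    (hmn : m ≤ n) : s ^ n * t ^ m ≤ t ^ n * s ^ m := by
  obtain ⟨d, rfl⟩ := Nat.exists_eq_add_of_le hmn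
  have h1 : s ^ d ≤ t ^ d := pow_le_pow_left₀ hs hst d
  have h2 : 0 ≤ s ^ m * t ^ m := mul_nonneg (pow_nonneg hs m) (pow_nonneg (hs.trans hst) m)
  calc s ^ (m + d) * t ^ m = s ^ d * (s ^ m * t ^ m) := by ring
    _ ≤ t ^ d * (s ^ m * t ^ m) := mul_le_mul_of_nonneg_right h1 h2
    _ = t ^ (m + d) * s ^ m := by ring

/-- Strict monomial comparison: for `0 < s < t` and `m < n`, `s^n t^m < t^n s^m`. -/
theorem certCrossing_pow_mul_pow_lt {s t : ℝ} (hs : 0 < s) (hst : s < t) {m n : ℕ}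
    (hmn : m < n) : s ^ n * t ^ m < t ^ n * s ^ m := by
  obtain ⟨d, rfl⟩ := Nat.exists_eq_add_of_lt hmn
  have h1 : s ^ (d + 1) < t ^ (d + 1) := pow_lt_pow_left₀ hst hs.le (by omega)
  have h2 : 0 < s ^ m * t ^ m := mul_pos (pow_pos hs m) (pow_pos (hs.trans hst) m)
  calc s ^ (m + d + 1) * t ^ m = s ^ (d + 1) * (s ^ m * t ^ m) := by ring
    _ < t ^ (d + 1) * (s ^ m * t ^ m) := mul_lt_mul_of_pos_right h1 h2
    _ = t ^ (m + d + 1) * s ^ m := by ring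

/-- Key monotonicity, division-free form of "`P(t)/t^{k+1}` is strictly increasing on `(0,∞)`"
for `P(t) = Σ_{q<K} c_q t^{q+1}` with `c_q ≤ 0` below `k`, `c_q ≥ 0` from `k` on, and some
`c_{q₀} < 0` with `q₀ < k`, `q₀ < K`: for `0 < s < t`, `P(s) t^{k+1} < P(t) s^{k+1}`. -/
theorem certCrossing_compare (K k : ℕ) (c : ℕ → ℝ)
    (hneg : ∀ q, q < k → c q ≤ 0) (hpos : ∀ q, k ≤ q → 0 ≤ c q)
    {q₀ : ℕ} (hq₀ : q₀ < k) (hq₀K : q₀ < K) (hc₀ : c q₀ < 0) {s t : ℝ} (hs : 0 < s)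
    (hst : s < t) :
    (∑ q ∈ Finset.range K, c q * s ^ (q + 1)) * t ^ (k + 1) <
      (∑ q ∈ Finset.range K, c q * t ^ (q + 1)) * s ^ (k + 1) := by
  rw [Finset.sum_mul, Finset.sum_mul]
  apply Finset.sum_lt_sum
  · intro q _
    rw [mul_assoc, mul_assoc]
    rcases lt_or_ge q k with hqk | hkq
    · refine mul_le_mul_of_nonpos_left ?_ (hneg q hqk)
      have h := certCrossing_pow_mul_pow_le hs.le hst.le (show q + 1 ≤ k + 1 by omega)
      calc t ^ (q + 1) * s ^ (k + 1) = s ^ (k + 1) * t ^ (q + 1) := mul_comm _ _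
        _ ≤ t ^ (k + 1) * s ^ (q + 1) := h
        _ = s ^ (q + 1) * t ^ (k + 1) := mul_comm _ _
    · exact mul_le_mul_of_nonneg_left
        (certCrossing_pow_mul_pow_le hs.le hst.le (show k + 1 ≤ q + 1 by omega)) (hpos q hkq)
  · refine ⟨q₀, Finset.mem_range.mpr hq₀K, ?_⟩
    rw [mul_assoc, mul_assoc]
    refine mul_lt_mul_of_neg_left ?_ hc₀
    have h := certCrossing_pow_mul_pow_lt hs hst (show q₀ + 1 < k + 1 by omega)
    calc t ^ (q₀ + 1) * s ^ (k + 1) = s ^ (k + 1) * t ^ (q₀ + 1) := mul_comm _ _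
      _ < t ^ (k + 1) * s ^ (q₀ + 1) := h
      _ = s ^ (q₀ + 1) * t ^ (k + 1) := mul_comm _ _

/-- Near `0⁺` the lowest strictly negative coefficient dominates: if `c_q ≤ 0` for `q < k` and
`c_{q₀} < 0` for some `q₀ < k`, `q₀ < K`, then `P(t) = Σ_{q<K} c_q t^{q+1} < 0` for some `t > 0`. -/
theorem certCrossing_exists_neg (K k : ℕ) (c : ℕ → ℝ) (hneg : ∀ q, q < k → c q ≤ 0)
    {q₀ : ℕ} (hq₀ : q₀ < k) (hq₀K : q₀ < K) (hc₀ : c q₀ < 0) :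
    ∃ t : ℝ, 0 < t ∧ ∑ q ∈ Finset.range K, c q * t ^ (q + 1) < 0 := by
  obtain ⟨G, hG⟩ : ∃ G : ℝ → ℝ, G = fun u => ∑ q ∈ Finset.Ico q₀ K, c q * u ^ (q - q₀) :=
    ⟨_, rfl⟩
  have hGc : Continuous G := by
    rw [hG]
    exact continuous_finsetSum _ fun q _ => by fun_prop
  have hG0 : G 0 = c q₀ := by
    rw [hG]
    show ∑ q ∈ Finset.Ico q₀ K, c q * (0 : ℝ) ^ (q - q₀) = c q₀
    rw [Finset.sum_eq_single_of_mem q₀ (Finset.mem_Ico.mpr ⟨le_rfl, hq₀K⟩)]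
    · simp
    · intro q hq hne
      have h : q - q₀ ≠ 0 := by
        have := (Finset.mem_Ico.mp hq).1
        omega
      simp [zero_pow h]
  have hev : ∀ᶠ u in nhdsWithin (0 : ℝ) (Set.Ioi 0), G u < 0 ∧ u ∈ Set.Ioi (0 : ℝ) := by
    have h1 : ∀ᶠ u in nhds (0 : ℝ), G u < 0 :=
      (hGc.tendsto 0).eventually_lt_const (by rw [hG0]; exact hc₀)
    exact (h1.filter_mono nhdsWithin_le_nhds).and self_mem_nhdsWithin
  obtain ⟨u, hGu, hu⟩ := hev.exists
  have hu0 : (0 : ℝ) < u := hu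
  refine ⟨u, hu0, ?_⟩
  rw [← Finset.sum_range_add_sum_Ico (fun q => c q * u ^ (q + 1)) hq₀K.le]
  have hlow : ∑ q ∈ Finset.range q₀, c q * u ^ (q + 1) ≤ 0 := by
    refine Finset.sum_nonpos fun q hq => ?_
    have hq' := Finset.mem_range.mp hq
    exact mul_nonpos_of_nonpos_of_nonneg (hneg q (by omega)) (pow_nonneg hu0.le _)
  have hhigh : ∑ q ∈ Finset.Ico q₀ K, c q * u ^ (q + 1) = u ^ (q₀ + 1) * G u := by
    rw [hG]
    show _ = u ^ (q₀ + 1) * ∑ q ∈ Finset.Ico q₀ K, c q * u ^ (q - q₀)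
    rw [Finset.mul_sum]
    refine Finset.sum_congr rfl fun q hq => ?_
    have hle := (Finset.mem_Ico.mp hq).1
    have h : q + 1 = (q₀ + 1) + (q - q₀) := by omega
    rw [h, pow_add u (q₀ + 1) (q - q₀)]
    ring
  have hneg' : u ^ (q₀ + 1) * G u < 0 := mul_neg_of_pos_of_neg (pow_pos hu0 _) hGu
  linarith

/-- Far out the top strictly positive coefficient (below `K`) dominates: if `c_q ≥ 0` for `q ≥ k`
and `c_{q₁} > 0` for some `k ≤ q₁ < K`, then `P(t) = Σ_{q<K} c_q t^{q+1} > 0` for some `t > 0`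
(substitute `t = 1/u` and let `u → 0⁺`). -/
theorem certCrossing_exists_pos (K k : ℕ) (c : ℕ → ℝ) (hpos : ∀ q, k ≤ q → 0 ≤ c q)
    {q₁ : ℕ} (hq₁ : k ≤ q₁) (hq₁K : q₁ < K) (hc₁ : 0 < c q₁) :
    ∃ t : ℝ, 0 < t ∧ 0 < ∑ q ∈ Finset.range K, c q * t ^ (q + 1) := by
  obtain ⟨H, hH⟩ :
      ∃ H : ℝ → ℝ, H = fun u => ∑ q ∈ Finset.range (q₁ + 1), c q * u ^ (q₁ - q) := ⟨_, rfl⟩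
  have hHc : Continuous H := by
    rw [hH]
    exact continuous_finsetSum _ fun q _ => by fun_prop
  have hH0 : H 0 = c q₁ := by
    rw [hH]
    show ∑ q ∈ Finset.range (q₁ + 1), c q * (0 : ℝ) ^ (q₁ - q) = c q₁
    rw [Finset.sum_eq_single_of_mem q₁ (Finset.mem_range.mpr (by omega))]
    · simp
    · intro q hq hne
      have h : q₁ - q ≠ 0 := by
        have := Finset.mem_range.mp hq
        omega
      simp [zero_pow h]
  have hev : ∀ᶠ u in nhdsWithin (0 : ℝ) (Set.Ioi 0), 0 < H u ∧ u ∈ Set.Ioi (0 : ℝ) := by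
    have h1 : ∀ᶠ u in nhds (0 : ℝ), 0 < H u :=
      (hHc.tendsto 0).eventually_const_lt (by rw [hH0]; exact hc₁)
    exact (h1.filter_mono nhdsWithin_le_nhds).and self_mem_nhdsWithin
  obtain ⟨u, hHu, hu⟩ := hev.exists
  have hu0 : (0 : ℝ) < u := hu
  have hune : u ≠ 0 := hu0.ne'
  refine ⟨u⁻¹, inv_pos.mpr hu0, ?_⟩
  rw [← Finset.sum_range_add_sum_Ico (fun q => c q * u⁻¹ ^ (q + 1)) (show q₁ + 1 ≤ K by omega)]
  have hhigh : 0 ≤ ∑ q ∈ Finset.Ico (q₁ + 1) K, c q * u⁻¹ ^ (q + 1) := by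
    refine Finset.sum_nonneg fun q hq => ?_
    have hq' := (Finset.mem_Ico.mp hq).1
    exact mul_nonneg (hpos q (by omega)) (pow_nonneg (inv_pos.mpr hu0).le _)
  have hlow : ∑ q ∈ Finset.range (q₁ + 1), c q * u⁻¹ ^ (q + 1) = u⁻¹ ^ (q₁ + 1) * H u := by
    rw [hH]
    show _ = u⁻¹ ^ (q₁ + 1) * ∑ q ∈ Finset.range (q₁ + 1), c q * u ^ (q₁ - q)
    rw [Finset.mul_sum]
    refine Finset.sum_congr rfl fun q hq => ?_
    have hle : q ≤ q₁ := by
      have := Finset.mem_range.mp hq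
      omega
    have h : q₁ + 1 = (q + 1) + (q₁ - q) := by omega
    have hpow : u⁻¹ ^ (q₁ - q) * u ^ (q₁ - q) = 1 := by
      rw [← mul_pow, inv_mul_cancel₀ hune, one_pow]
    rw [h, pow_add u⁻¹ (q + 1) (q₁ - q)]
    linear_combination (-(c q * u⁻¹ ^ (q + 1))) * hpow
  have hpos' : 0 < u⁻¹ ^ (q₁ + 1) * H u := mul_pos (pow_pos (inv_pos.mpr hu0) _) hHu
  linarith

/-- Abstract one-crossing principle.  If `P` is continuous, satisfies the comparison
`P(s) t^{k+1} < P(t) s^{k+1}` for `0 < s < t`, and takes a negative and a positive value on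
`(0,∞)`, then for some `t₀ > 0`, `P < 0` on `(0,t₀)` and `P ≥ 0` on `[t₀,∞)`. -/
theorem certCrossing_of_compare (P : ℝ → ℝ) (k : ℕ) (hPc : Continuous P)
    (key : ∀ s t : ℝ, 0 < s → s < t → P s * t ^ (k + 1) < P t * s ^ (k + 1))
    (h₁ : ∃ t : ℝ, 0 < t ∧ P t < 0) (h₂ : ∃ t : ℝ, 0 < t ∧ 0 < P t) :
    ∃ t₀ : ℝ, 0 < t₀ ∧ (∀ t ∈ Set.Ioo 0 t₀, P t < 0) ∧ (∀ t, t₀ ≤ t → 0 ≤ P t) := by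
  have up : ∀ s t : ℝ, 0 < s → s < t → 0 ≤ P s → 0 < P t := by
    intro s t hs hst hPs
    have h2 : 0 ≤ P s * t ^ (k + 1) := mul_nonneg hPs (pow_nonneg (hs.le.trans hst.le) _)
    exact pos_of_mul_pos_left (h2.trans_lt (key s t hs hst)) (pow_nonneg hs.le _)
  have down : ∀ s t : ℝ, 0 < s → s < t → P t ≤ 0 → P s < 0 := by
    intro s t hs hst hPt
    have h2 : P t * s ^ (k + 1) ≤ 0 := mul_nonpos_of_nonpos_of_nonneg hPt (pow_nonneg hs.le _)
    exact neg_of_mul_neg_left ((key s t hs hst).trans_le h2) (pow_nonneg (hs.le.trans hst.le) _)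
  obtain ⟨t₁, ht₁, hP₁⟩ := h₁
  obtain ⟨t₂, ht₂, hP₂⟩ := h₂
  have ht₁₂ : t₁ ≤ t₂ := by
    by_contra h
    have := up t₂ t₁ ht₂ (not_le.mp h) hP₂.le
    linarith
  obtain ⟨t₀, ht₀mem, hPt₀⟩ := intermediate_value_Icc ht₁₂ hPc.continuousOn ⟨hP₁.le, hP₂.le⟩
  refine ⟨t₀, ht₁.trans_le ht₀mem.1, fun t ht => down t t₀ ht.1 ht.2 hPt₀.le, fun t ht => ?_⟩
  rcases ht.eq_or_lt with rfl | hlt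
  · exact hPt₀.ge
  · exact (up t₀ t (ht₁.trans_le ht₀mem.1) hlt hPt₀.ge).le

/-- STUB S4b (Descartes, one sign change ⇒ one crossing). If `b_q ≤ 0` for `q < k`, `b_q ≥ 0`
for `q ≥ k`, some `b_q < 0` below `k` and some `b_q > 0` at or above `k` (and below `K`), then
`a(t) = e^{-σt} Σ_{q<K} b_q σ^{q+2} t^{q+1}/(q+1)!` is `≤ 0` on `(0,t₀)` and `≥ 0` on `[t₀,∞)` for
some `t₀ > 0` (`t^{-(k+1)} e^{σt} a(t)` is strictly increasing). -/
theorem stub_cert_crossing (σ : ℝ) (hσ : 0 < σ) (K k : ℕ) (b : ℕ → ℝ)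
    (hneg : ∀ q, q < k → b q ≤ 0) (hpos : ∀ q, k ≤ q → 0 ≤ b q)
    (hex_neg : ∃ q, q < k ∧ b q < 0) (hex_pos : ∃ q, k ≤ q ∧ q < K ∧ 0 < b q)
    (a : ℝ → ℝ)
    (ha : a = fun t => Real.exp (-(σ * t)) *
      ∑ q ∈ Finset.range K, b q * σ ^ (q + 2) * t ^ (q + 1) / ((q + 1)! : ℝ)) :
    ∃ t₀ : ℝ, 0 < t₀ ∧ (∀ t ∈ Set.Ioo 0 t₀, a t ≤ 0) ∧ (∀ t, t₀ ≤ t → 0 ≤ a t) := by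
  obtain ⟨q₀, hq₀k, hbq₀⟩ := hex_neg
  obtain ⟨q₁, hkq₁, hq₁K, hbq₁⟩ := hex_pos
  have hq₀K : q₀ < K := by omega
  subst ha
  -- normalised coefficients `c_q = b_q σ^{q+2}/(q+1)!`, of the same sign as `b_q`
  obtain ⟨c, hc⟩ : ∃ c : ℕ → ℝ, c = fun q => b q * (σ ^ (q + 2) / ((q + 1)! : ℝ)) := ⟨_, rfl⟩
  have hfac : ∀ q : ℕ, 0 < σ ^ (q + 2) / ((q + 1)! : ℝ) := fun q => by positivity
  have hcneg : ∀ q, q < k → c q ≤ 0 := fun q hq => by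
    rw [hc]
    exact mul_nonpos_of_nonpos_of_nonneg (hneg q hq) (hfac q).le
  have hcpos : ∀ q, k ≤ q → 0 ≤ c q := fun q hq => by
    rw [hc]
    exact mul_nonneg (hpos q hq) (hfac q).le
  have hc₀ : c q₀ < 0 := by
    rw [hc]
    exact mul_neg_of_neg_of_pos hbq₀ (hfac q₀)
  have hc₁ : 0 < c q₁ := by
    rw [hc]
    exact mul_pos hbq₁ (hfac q₁)
  have hsum : ∀ t : ℝ, ∑ q ∈ Finset.range K, b q * σ ^ (q + 2) * t ^ (q + 1) / ((q + 1)! : ℝ) =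
      ∑ q ∈ Finset.range K, c q * t ^ (q + 1) := fun t =>
    Finset.sum_congr rfl fun q _ => by simp only [hc]; ring
  obtain ⟨t₀, ht₀, hlt, hge⟩ := certCrossing_of_compare
    (fun t => ∑ q ∈ Finset.range K, c q * t ^ (q + 1)) k
    (continuous_finsetSum _ fun q _ => by fun_prop)
    (fun s t hs hst => certCrossing_compare K k c hcneg hcpos hq₀k hq₀K hc₀ hs hst)
    (certCrossing_exists_neg K k c hcneg hq₀k hq₀K hc₀)
    (certCrossing_exists_pos K k c hcpos hkq₁ hq₁K hc₁)
  refine ⟨t₀, ht₀, fun t ht => ?_, fun t ht => ?_⟩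
  · show Real.exp (-(σ * t)) *
      ∑ q ∈ Finset.range K, b q * σ ^ (q + 2) * t ^ (q + 1) / ((q + 1)! : ℝ) ≤ 0
    rw [hsum t]
    exact mul_nonpos_of_nonneg_of_nonpos (Real.exp_pos _).le (hlt t ht).le
  · show 0 ≤ Real.exp (-(σ * t)) *
      ∑ q ∈ Finset.range K, b q * σ ^ (q + 2) * t ^ (q + 1) / ((q + 1)! : ℝ)
    rw [hsum t]
    exact mul_nonneg (Real.exp_pos _).le (hge t ht)

end Summit.AtomisticToContinuum.Crystallization.Theorems
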